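import Summits.ABC.IUTFork.Repair.ScalarShellsThm311Zero
import HarnessLib

/-!
# IUT REPAIR branch (rung LADDER-ABC:A2.RP) — SCAL profile cells of the Joshi level-S readings on the scaling-shells beds, UNFOLDED

Proof-only companion (no `def`, no `instance`, no new `Prop`) by abc-iut-w4-d098 (gen 3; one builder of the scaling-shells bed, paired prover
of B3). The two Joshi readings of abc-iut-rp-j2's `Repair/CandJoshi21.lean` that concern the INDETERMINACY GROUP —
H_J21-2 `JoshiScalingIndeterminacy S P qK := ∃ Φ ∈ ⟨(Ind1) ∪ (Ind2)⟩, ∀ v hv, qK v hv = starAut Φ v '' (S.D P.n).Ψ v hv` and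
H_J21-5 `JoshiNonIsometricIndeterminacy S₀ n := ∃ Φ ∈ ⟨(Ind1) ∪ (Ind2)⟩, ∃ j vQ A, Adm A ∧ logvol (Φ '' A) ≠ logvol A` —
are decided here on the beds `sFull p` (layer 2) and `sFull₀ p` (layer 2b) with their DEFINING FORMULAS WRITTEN OUT, because the module
`Repair.CandJoshi21` has had no olean since its acceptance (05:59Z) and cannot be imported; the H-vocabulary restatements (`Iff.rfl`) follow in
`Repair/CandJoshi21Models.lean` when it builds. TAKES NO SIDE on [IUTchIII] Cor. 3.12 or on any author; toys over `toyIndex`.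

CELLS (REPAIR-SPEC §3 T-b/T-c, PROFILE v0.4 point SCAL):
* `scal_H2_unfolded₀` / `scal_H2_unfolded` — H_J21-2 HOLDS for EVERY Cor.-3.12 setting over `sFull₀ p` / `sFull p` with `qK = qDatum p`, by the
  GENUINE rescaling `sFamDep (cQ p) = (1, 1, p⁻¹)` (`starAut_cQ_Psi`), not by a sign (contrast: Φ = 1 at P♭; fails on LS / FLIP);
* `scal_H5_unfolded₀` / `scal_H5_unfolded` — H_J21-5 HOLDS at every line (the (Ind2)-family «multiply by p» changes the volume of `B_0`),
  together with the typed Thm. 3.11 (`sFull₀_statement` / `sFull_statement`): SAT(situation) with Step (x) FAILING = door (b).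
[claim: Mochizuki2012, status: disputed]
-/

noncomputable section

namespace Summit.ABC.IUTFork.Repair.ScalarShellsJoshiCells

open Thm311 Cor312 Cor312.Checks Cor312.IdentifiedNonVacuity Cor312Vol.NaiveWitness Cor312Vol.UnitWitness Cor312Vol.PinnedWitness
  Literature.IUT.LogThetaLattice Summit.ABC.IUTFork.Repair.ScalarShells Summit.ABC.IUTFork.Repair.ScalarShellsThm311
  Summit.ABC.IUTFork.Repair.ScalarShellsThm311Zero

variable (p : ℕ) [hp : Fact p.Prime]

/-- **H_J21-2, unfolded, on the `{0}`-admissible bed**: for every setting `P` over `sFull₀ p` there is `Φ ∈ ⟨(Ind1) ∪ (Ind2)⟩` of the scaling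
shells with `qDatum p v hv = starAut Φ v '' (D P.n).Ψ v hv` at every bad place — namely `Φ = sFamDep (cQ p)`. [folklore] -/
theorem scal_H2_unfolded₀ (P : Cor312.Setting (sFull₀ p).toLatticeSituation.toSituation) :
    ∃ Φ ∈ Subgroup.closure ((scalingShells p).Ind1Family ∪ (scalingShells p).Ind2Family),
      ∀ (v : toyIndex.V) (hv : v ∈ toyIndex.Vbad),
        qDatum p v hv = (scalingShells p).starAut Φ v '' ((sFull₀ p).D P.n).Ψ v hv :=
  ⟨sFamDep p (cQ p), sFamDep_mem_closure p _, fun v hv => (starAut_cQ_Psi p v hv).symm⟩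

/-- **H_J21-2, unfolded, on the layer-2 bed** `sFull p` (pin-free uses). [folklore] -/
theorem scal_H2_unfolded (P : Cor312.Setting (sFull p).toLatticeSituation.toSituation) :
    ∃ Φ ∈ Subgroup.closure ((scalingShells p).Ind1Family ∪ (scalingShells p).Ind2Family),
      ∀ (v : toyIndex.V) (hv : v ∈ toyIndex.Vbad),
        qDatum p v hv = (scalingShells p).starAut Φ v '' ((sFull p).D P.n).Ψ v hv :=
  ⟨sFamDep p (cQ p), sFamDep_mem_closure p _, fun v hv => (starAut_cQ_Psi p v hv).symm⟩

/-- **H_J21-5, unfolded, on the `{0}`-admissible bed**, with the typed Thm. 3.11: at every line `n` some element of the indeterminacy group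
changes the log-volume of an admissible region, and `(sFull₀ p).Statement` holds. [folklore] -/
theorem scal_H5_unfolded₀ (n : ℤ) :
    (∃ Φ ∈ Subgroup.closure ((scalingShells p).Ind1Family ∪ (scalingShells p).Ind2Family),
      ∃ (j : toyIndex.Label) (vQ : toyIndex.VQ) (A : Set ((scalingShells p).Packet j vQ)),
        ((sSituation₀ p).D n).Adm j vQ A ∧
          ((sSituation₀ p).D n).logvol j vQ (Φ j vQ '' A) ≠ ((sSituation₀ p).D n).logvol j vQ A) ∧
      (sFull₀ p).Statement := by
  obtain ⟨Φ, hΦ, hadm, hne⟩ := logvol_not_invariant₀ p 0 () 0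
  exact ⟨⟨Φ, hΦ, 0, (), _, hadm, hne⟩, sFull₀_statement p⟩

/-- **H_J21-5, unfolded, on the layer-2 bed**, with the typed Thm. 3.11. [folklore] -/
theorem scal_H5_unfolded (n : ℤ) :
    (∃ Φ ∈ Subgroup.closure ((scalingShells p).Ind1Family ∪ (scalingShells p).Ind2Family),
      ∃ (j : toyIndex.Label) (vQ : toyIndex.VQ) (A : Set ((scalingShells p).Packet j vQ)),
        ((sSituation p).D n).Adm j vQ A ∧
          ((sSituation p).D n).logvol j vQ (Φ j vQ '' A) ≠ ((sSituation p).D n).logvol j vQ A) ∧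
      (sFull p).Statement := by
  obtain ⟨Φ, hΦ, hadm, hne⟩ := logvol_not_invariant p 0 () 0
  exact ⟨⟨Φ, hΦ, 0, (), _, hadm, hne⟩, sFull_statement p⟩

/-- **The witness of H_J21-2 is NOT a sign/unit move**: it changes the log-volume of the ball `B_0` at label `2` (by `+3·log p`), so it lies
outside every isometric indeterminacy class — the SCAL cell is non-(Ind)-trivial in the sense of PROFILE v0.4. [folklore] -/
theorem scal_H2_witness_moves_ball :
    sFamDep p (cQ p) 2 () '' sBall p ⊤ 2 () 0 = sBall p ⊤ 2 () (-3) ∧ sBall p ⊤ 2 () (-3) ≠ sBall p ⊤ 2 () 0 := by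
  have hv : padicValRat p (((cQ p 2 : ℚˣ) : ℚ)) = -1 := by
    have h2 : (((2 : toyIndex.Label) : ℕ)) = 2 := rfl
    simp only [cQ, h2, if_true]
    rw [Units.val_inv_eq_inv_val, padicValRat.inv, padicValRat_pUnit]
  refine ⟨?_, fun h => ?_⟩
  · rw [image_sBall_sFamDep, hv]
    rfl
  · have := sBall_injective p ⊤ 2 () h
    omega

end Summit.ABC.IUTFork.Repair.ScalarShellsJoshiCells

end
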